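import Summits.BirchSwinnertonDyer.BirchSwinnertonDyer.Theorems.RamifiedSevenEllipticUnitsRubinPackageReduction
import Summits.BirchSwinnertonDyer.BirchSwinnertonDyer.Theorems.RamifiedSevenEllipticUnitsLemmaXi
import Summits.BirchSwinnertonDyer.Rank1Residual.X12.O11.RouteUTwistCM
import Summits.BirchSwinnertonDyer.Rank1Residual.X12.O11.RamifiedRubinPackageReducedLineZp
import Literature.NumberTheory.EllipticCurves.BurungaleKobayashiNakamuraOta2026.CentralRootNumberWtOfHeckeProofs
import HarnessLib

set_option linter.dupNamespace false
set_option autoImplicit false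

/-!
# Route `RamifiedSevenEllipticUnits` (K7r), Value crux `EllipticUnitValueSevenOfGZK`
# (stmt-BirchSwinnertonDyer-19945), line `rubin-formula-zp`: THE v4.1 ASSEMBLY of the registered package
# `S_pkg` from the reduced package `S_pkg⁻`, the pinned-character structure H_Rig, Hecke's functional
# equation (named fact) and the classical inputs H_QR, H_V in the `(hinf, heq)` currency
# (cell `bsd-cm`, planner D141 (d) / D144 (b1)–(b3) / D147 (a); line owner `bsd-cm-k7r-c4` g9; helper
# `--supports` 19945; THEOREMS ONLY, nothing asserted)

With the four typed inputs of `X12/O11/RamifiedRubinPackageReducedLineZp.lean` and the Literature named fact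
`Hecke_functionalEquation_infinityType` in hand, the registered stub `S_pkg = X12.O11.RamifiedCMRubinPackageAtZp
W p D₀` of skeleton v4 follows in the kernel:
* `S_pkg⁻` (`RamifiedCMRubinPackageReducedAtZp`) supplies `(cK ≠ 1, R, Ω₀, 𝓔₀, D₀', R₀)` with (P4), (P6),
  (P7), (P8);
* H_Rig (`RamifiedCMPinnedCharacterStructureAtZp`) at the member `W` and at the base model `W₀` — both CM
  with field `ℚ(√−7)` (`IsFrame`, `RouteU.hasCM_of_twist_cm7`, `RouteU.cmFieldDiscrOfJ_of_twist_cm7`) —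
  gives Deuring-type `ψ`, `ψ₀` (type `(1,0)`, conj-equivariant, pinned) with the telescope's
  `φ ∈ {ψ, ψ∘cK}`, `φ₀ ∈ {ψ₀, ψ₀∘cK}`;
* §1 TRANSPORT along `galConj` (PROVED here): root numbers (`isCentralRootNumberWt_galConj_pow_iff`, by
  `heckeLFunction_galConj` + `galConj_pow`), pinning (`pinned_galConj`) and quadratic ramification of a
  conj-equivariant character (`quadraticRamification_galConj`, by `IsHeckeConjEquivariant.isUnramifiedAt_galConj_iff'`);
* Hecke's functional equation (`BurungaleKobayashiNakamuraOta2026.exists_isCentralRootNumberWt_pow`, littype-10,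
  modulo the named fact) and H_QR (`RamifiedCMQuadraticRamificationAtZp`) at `ψ`, `ψ₀`, transported, feed
  seat k7r-c3 g10's reduction (`isCentralRootNumberWt_interpolated_one_of_xi`,
  `not_isUnramifiedAt_interpolated_of_xi`, p498275): clauses (P2) and (P3);
* H_V (`RamifiedCMAcCharacterValuesAtZp`) feeds seat k7r-c2 g7's LEMMA Ξ (`RubinPadicLFunctionData.ξ_eq_φac`,
  `….norm_avatarValueAt_sub_one_sq_eq_of_φac`, p500363): clauses (P1) and (P5) for `R` and `R₀`.
Hypotheses `cmFieldDiscrOfJ W.j = −7` (a conjunct of `X12.ClassCSeven`) and `D₀ ≠ 0` (the base twist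
parameter; `−11` in the skeleton). The v4.1 skeleton line is
`stub_rubinPackageSevenZp W hC := rubinPackage_of_structure_of_reduced hC.2.1 (by norm_num) stub_hecke
(stub_Rig W hC) (stub_QR W hC) (stub_V W hC) (stub_red W hC)`. CONDITIONAL on the inputs; nothing about
[BKNO]'s objects or Hecke's theorem is asserted; 19945 stays OPEN; BSD is not proved for any curve.
[cite: BurungaleKobayashiNakamuraOta2026, Def. 4.2, Def. 4.7, Thm. 4.12, Thm. 7.2 (arXiv:2608.06879 pp. 24, 27, 32, 41; claim; preprint; shape only)]
[cite: deShalit1987, II.1.1 (1)–(3) (Hecke's functional equation; the named fact)]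
-/

noncomputable section

open scoped Classical

open WeierstrassCurve NumberField IsDedekindDomain Field PowerSeries
  Literature.NumberTheory.EllipticCurves
  Literature.NumberTheory.EllipticCurves.Rank1Residual
  Literature.NumberTheory.EllipticCurves.Rank1Residual.Typed
  Literature.NumberTheory.EllipticCurves.Castella2018
  Literature.NumberTheory.EllipticCurves.BurungaleKobayashiNakamuraOta2026
  Literature.NumberTheory.GaloisRepresentations
  Literature.NumberTheory.DiophantineGeometry
  Summit.BirchSwinnertonDyer.Rank1Residual.Additive

namespace Summit.BirchSwinnertonDyer.BirchSwinnertonDyer.Theorems.RamifiedSevenEllipticUnits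

namespace RubinPackageOfReduced

open Summit.BirchSwinnertonDyer.Rank1Residual Summit.BirchSwinnertonDyer.Rank1Residual.X12
  Summit.BirchSwinnertonDyer.Rank1Residual.X12.O11

/-! ## §1 Transport along Galois conjugation of the character -/

section Transport

variable {K : Type} [Field K] [NumberField K]

/-- **Root numbers are invariant under Galois conjugation of the character**: `IsCentralRootNumberWt` reads
the character only through `heckeLFunction`, and `L(χ ∘ σ, s) = L(χ, s)` (`heckeLFunction_galConj`), with
`(χ ∘ σ)ⁿ = χⁿ ∘ σ` (`galConj_pow`). [cite: NeukirchANT1999, Ch. VII §8 (8.1) (the Euler product; shape only)] -/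
theorem isCentralRootNumberWt_galConj_pow_iff (σ : K ≃ₐ[ℚ] K) (ψ : HeckeCharacter K) (n k : ℕ) (w : ℂ) :
    IsCentralRootNumberWt (HeckeCharacter.galConj σ ψ ^ n) k w ↔ IsCentralRootNumberWt (ψ ^ n) k w := by
  unfold IsCentralRootNumberWt
  simp only [← galConj_pow, heckeLFunction_galConj]

/-- **Pinning is invariant under Galois conjugation of the character** (`L(χ ∘ σ, s) = L(χ, s)`).
[cite: NeukirchANT1999, Ch. VII §8 (8.1) (shape only)] -/
theorem pinned_galConj {V : WeierstrassCurve ℚ} (σ : K ≃ₐ[ℚ] K) {ψ : HeckeCharacter K}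
    (hψ : ∀ s : ℂ, 3 / 2 < s.re → heckeLFunction ψ s = V.LSeries s) :
    ∀ s : ℂ, 3 / 2 < s.re → heckeLFunction (HeckeCharacter.galConj σ ψ) s = V.LSeries s :=
  fun s hs ↦ by rw [heckeLFunction_galConj, hψ s hs]

/-- **Quadratic ramification transports to the conjugate of a conj-equivariant character**
(`IsHeckeConjEquivariant.isUnramifiedAt_galConj_iff'` for `ψ` and for `ψ²`, `galConj_pow`).
[cite: Jia2026ActaArith, §1 (equivariant characters; shape only)] -/
theorem quadraticRamification_galConj {c : K ≃ₐ[ℚ] K} {ψ : HeckeCharacter K}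
    {𝔭 : HeightOneSpectrum (𝓞 K)} (heq : IsHeckeConjEquivariant c ψ)
    (h : ¬ ψ.IsUnramifiedAt 𝔭 ∧ ∀ w, ¬ ψ.IsUnramifiedAt w → (ψ ^ 2).IsUnramifiedAt w) :
    ¬ (HeckeCharacter.galConj c ψ).IsUnramifiedAt 𝔭 ∧
      ∀ w, ¬ (HeckeCharacter.galConj c ψ).IsUnramifiedAt w →
        (HeckeCharacter.galConj c ψ ^ 2).IsUnramifiedAt w := by
  refine ⟨fun h𝔭 ↦ h.1 ((heq.isUnramifiedAt_galConj_iff' 𝔭).1 h𝔭), fun w hw ↦ ?_⟩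
  rw [← galConj_pow, (heq.pow 2).isUnramifiedAt_galConj_iff']
  exact h.2 w (fun hw' ↦ hw ((heq.isUnramifiedAt_galConj_iff' w).2 hw'))

end Transport

/-! ## §2 The assembly -/

section Assembly

variable {W : WeierstrassCurve ℚ} [W.IsElliptic] [W.IsGloballyMinimal] {p : ℕ} [Fact p.Prime] {D₀ : ℤ}

omit [W.IsGloballyMinimal] in
/-- **THE v4.1 ASSEMBLY: `Hecke FE fact → H_Rig → H_QR → H_V → S_pkg⁻ → S_pkg`** for a curve with CM field
`ℚ(√−7)` (`cmFieldDiscrOfJ W.j = −7`) and a base twist parameter `D₀ ≠ 0`. Inside `S_pkg`'s telescope: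
destructure `S_pkg⁻`; the member `W` (from the frame) and the base model `W₀` (a model of `cm7^{(D₀)}`)
are CM with the same field, so H_Rig gives Deuring-type `ψ`, `ψ₀` with the telescope's `φ ∈ {ψ, ψ∘cK}`,
`φ₀ ∈ {ψ₀, ψ₀∘cK}`; Hecke's functional equation (`exists_isCentralRootNumberWt_pow`, modulo the named fact
`Hecke_functionalEquation_infinityType`) and H_QR transport along `galConj`; H_V + LEMMA Ξ give (P1)/(P5);
k7r-c3's reduction gives (P2)/(P3). CONDITIONAL; nothing booked.
[cite: BurungaleKobayashiNakamuraOta2026, Def. 4.7 and Thm. 4.12 (arXiv:2608.06879 pp. 27, 32; claim; preprint; shape only)]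
[cite: deShalit1987, II.1.1 (1)–(3) (Hecke's functional equation; the named fact)] -/
theorem rubinPackage_of_structure_of_reduced (hj : cmFieldDiscrOfJ W.j = -7) (hD₀ : D₀ ≠ 0)
    (hHecke : Hecke_functionalEquation_infinityType)
    (hRig : RamifiedCMPinnedCharacterStructureAtZp W p) (hQR : RamifiedCMQuadraticRamificationAtZp W p)
    (hV : RamifiedCMAcCharacterValuesAtZp W p) (hred : RamifiedCMRubinPackageReducedAtZp W p D₀) :
    RamifiedCMRubinPackageAtZp W p D₀ := by
  intro K _ _ 𝔭 W' _ _ C hF hr κ hκ γ _ P n P' n' hP hgen htors hdiv hndiv hP' hgen' htors' hdiv' hndiv'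
    q q' hq hq' ι φ Ω 𝓔 D c hΩ hφ hc himc l hl W₀ _ _ hW₀ φ₀ hφ₀ m r hcont hcont₀ hρ hr0 hlt
  obtain ⟨cK, hcK, R, Ω₀, 𝓔₀, D₀', R₀, hΩ₀, hbase, hper, hbottom⟩ :=
    hred K 𝔭 W' C hF hr κ hκ γ P n P' n' hP hgen htors hdiv hndiv hP' hgen' htors' hdiv' hndiv' q q' hq hq'
      ι φ Ω 𝓔 D c hΩ hφ hc himc l hl W₀ hW₀ φ₀ hφ₀ m r hcont hcont₀ hρ hr0 hlt
  -- the frame: `K` imaginary quadratic; the member and the base model are CM with the same field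
  have hK : IsImaginaryQuadratic K := hF.2.2.2.1
  have hWcm : W.HasCM := hF.1
  have hW₀cm : W₀.HasCM := RouteU.hasCM_of_twist_cm7 W₀ hD₀ hW₀
  have hW₀j : cmFieldDiscrOfJ W₀.j = cmFieldDiscrOfJ W.j := by
    rw [RouteU.cmFieldDiscrOfJ_of_twist_cm7 W₀ hD₀ hW₀, hj]
  -- H_Rig: the Deuring-type characters and the position of `φ`, `φ₀`
  obtain ⟨ψ, hinf, heq, hψ, hrig⟩ := hRig K 𝔭 W' C hF W hWcm rfl cK hcK
  obtain ⟨ψ₀, hinf₀, heq₀, hψ₀, hrig₀⟩ := hRig K 𝔭 W' C hF W₀ hW₀cm hW₀j cK hcK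
  have hφcase : φ = ψ ∨ φ = HeckeCharacter.galConj cK ψ := hrig φ hφ
  have hφ₀case : φ₀ = ψ₀ ∨ φ₀ = HeckeCharacter.galConj cK ψ₀ := hrig₀ φ₀ hφ₀
  -- (P1)/(P5) for `R` and `R₀` from H_V through LEMMA Ξ
  obtain ⟨hall, hone⟩ := hV K 𝔭 W' C hF W hWcm rfl ι cK hcK ψ hinf heq hψ φ hφcase
  obtain ⟨hall₀, hone₀⟩ := hV K 𝔭 W' C hF W₀ hW₀cm hW₀j ι cK hcK ψ₀ hinf₀ heq₀ hψ₀ φ₀ hφ₀case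
  have hu : ‖avatarValueAt R.r γ - 1‖ ^ 2 = ((p : ℝ))⁻¹ :=
    RubinPadicLFunctionData.norm_avatarValueAt_sub_one_sq_eq_of_φac R hall hone
  have hu₀ : ‖avatarValueAt R₀.r γ - 1‖ ^ 2 = ((p : ℝ))⁻¹ :=
    RubinPadicLFunctionData.norm_avatarValueAt_sub_one_sq_eq_of_φac R₀ hall₀ hone₀
  have hp1 : ((p : ℝ))⁻¹ < 1 := inv_lt_one_of_one_lt₀ (by exact_mod_cast (Fact.out : p.Prime).one_lt)
  have hξ : R.ξ = φ * (HeckeCharacter.galConj cK φ)⁻¹ := by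
    obtain ⟨S, hS, hS'⟩ := hall
    exact RubinPadicLFunctionData.ξ_eq_φac R
      ⟨S, hS, fun v hv ↦ ⟨(hS' v hv).2.1, LemmaXi.norm_lt_one_of_sq_le (hS' v hv).2.2 hp1⟩⟩
  have hξ₀ : R₀.ξ = φ₀ * (HeckeCharacter.galConj cK φ₀)⁻¹ := by
    obtain ⟨S, hS, hS'⟩ := hall₀
    exact RubinPadicLFunctionData.ξ_eq_φac R₀
      ⟨S, hS, fun v hv ↦ ⟨(hS' v hv).2.1, LemmaXi.norm_lt_one_of_sq_le (hS' v hv).2.2 hp1⟩⟩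
  -- (P2): Hecke's functional equation for `ψ^{2k+1}`, `ψ₀^{2k+1}`, transported to `φ`, `φ₀`
  have hw : ∃ w : ℂ, IsCentralRootNumberWt (φ ^ (2 * p ^ m + 1)) (p ^ m) w := by
    obtain ⟨w, -, hw⟩ := exists_isCentralRootNumberWt_pow hHecke hK hinf heq (p ^ m)
    rcases hφcase with h | h
    · exact ⟨w, h ▸ hw⟩
    · exact ⟨w, h ▸ (isCentralRootNumberWt_galConj_pow_iff cK ψ _ _ w).2 hw⟩
  have hw₀ : ∃ w : ℂ, IsCentralRootNumberWt (φ₀ ^ (2 * p ^ m + 1)) (p ^ m) w := by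
    obtain ⟨w, -, hw⟩ := exists_isCentralRootNumberWt_pow hHecke hK hinf₀ heq₀ (p ^ m)
    rcases hφ₀case with h | h
    · exact ⟨w, h ▸ hw⟩
    · exact ⟨w, h ▸ (isCentralRootNumberWt_galConj_pow_iff cK ψ₀ _ _ w).2 hw⟩
  obtain ⟨w, hw⟩ := hw
  obtain ⟨w₀, hw₀⟩ := hw₀
  have hsgn := RubinPackageReduction.isCentralRootNumberWt_interpolated_one_of_xi hξ hξ₀ hw hw₀ hρ hr0
  -- (P3): H_QR for `ψ`, `ψ₀`, transported to `φ`, `φ₀`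
  have hQRφ : ¬ φ.IsUnramifiedAt 𝔭 ∧ ∀ w, ¬ φ.IsUnramifiedAt w → (φ ^ 2).IsUnramifiedAt w := by
    have h := hQR K 𝔭 W' C hF W hWcm rfl cK hcK ψ hinf heq hψ
    rcases hφcase with h' | h'
    · exact h' ▸ h
    · exact h' ▸ quadraticRamification_galConj heq h
  have hQRφ₀ : ¬ φ₀.IsUnramifiedAt 𝔭 ∧ ∀ w, ¬ φ₀.IsUnramifiedAt w → (φ₀ ^ 2).IsUnramifiedAt w := by
    have h := hQR K 𝔭 W' C hF W₀ hW₀cm hW₀j cK hcK ψ₀ hinf₀ heq₀ hψ₀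
    rcases hφ₀case with h' | h'
    · exact h' ▸ h
    · exact h' ▸ quadraticRamification_galConj heq₀ h
  exact ⟨cK, R, Ω₀, 𝓔₀, D₀', R₀, hξ, hξ₀, hsgn.1, hsgn.2,
    RubinPackageReduction.not_isUnramifiedAt_interpolated_of_xi hξ hQRφ.1 hQRφ.2 (p ^ m),
    RubinPackageReduction.not_isUnramifiedAt_interpolated_of_xi hξ₀ hQRφ₀.1 hQRφ₀.2 (p ^ m),
    hΩ₀, hu, hu₀, hbase, hper, hbottom⟩

end Assembly

end RubinPackageOfReduced

end Summit.BirchSwinnertonDyer.BirchSwinnertonDyer.Theorems.RamifiedSevenEllipticUnits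

end
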